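import Summits.CriticalPhenomena.PercolationContinuityZ3.Theorems.PercNearOneGluingNoHeavyLowerTailPatternLightestStarCore
import Summits.CriticalPhenomena.PercolationContinuityZ3.Theorems.PercNearOneGluingNoHeavyLowerTailCILRelayNeighboursHolds
import Summits.CriticalPhenomena.PercolationContinuityZ3.Theorems.PercNearOneGluingNoHeavyLowerTailTieLocusCorner
import HarnessLib

/-!
# `NoHeavyLowerTail` (stmt-CriticalPhenomena-4575) — pattern-lightest bound for relay-neighboured observers, part 2:
# the loss comparison (TOP') for an observer whose positive-weight neighbours are relays

Support file (prover `prim-hp-8`; `--supports stmt-CriticalPhenomena-4575`).  No definitions, no named facts, no sorries.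

* `hyp_of_gluedStar`: when the weights at `o` are `0/1`, `o` is glued to a nonempty relay set `U` containing a relay no more
  light-prone than `p` in the graph `H` without the edges at `o`, and `v s(o,p) = 0`, then `μ(o ↮ p, |π(o)| ≤ j) ≤ μ(o ↮ p, |π(p)| ≤ j)`
  — `observerSet_le_of_lonelier` in `H`, transferred by `CutObserver.measureReal_preimage_avoid`.
* `selfGluingLoss_ge_star` (**(TOP')**): if `o ∉ A ∋ p`, `v s(o,p) = 0`, and every other positive-weight edge at `o` goes to a
  relay no more light-prone than `p` in `H`, then `loss(x) ≤ loss(p)` for every `x ≠ o`.  The losses are affine in each other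
  weight at `o`, so it suffices to treat `0/1` weights at `o`: either `o` is isolated (`loss(x) = 0 ≤ loss(p)`) or part 1
  applies with the hypothesis above.
-/

noncomputable section

namespace Summit.CriticalPhenomena.PercolationContinuityZ3.Theorems

namespace PatternLightestStar

open MeasureTheory Set Literature.Probability.LatticeModels Literature.Probability.Percolation
open scoped Classical

variable {n : ℕ}

/-! ### Discharging the hypothesis: deterministic star at `o` -/

/-- On a configuration whose open edges at `o` are exactly the edges to `U` (`o ∉ U`), reachability from `o` is reachability
from some `y ∈ U` avoiding `o`. [folklore] -/
theorem reachable_from_obs_iff (ω : BondConfig (Fin n)) {o : Fin n} (U : Finset (Fin n)) (hoU : o ∉ U)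
    (hG : ∀ y : Fin n, s(o, y) ∈ ω ↔ y ∈ U) (z : Fin n) (hz : z ≠ o) :
    (openGraph ω).Reachable o z ↔ ∃ y ∈ U, (openGraph (ω ∩ {e | o ∉ e})).Reachable y z := by
  constructor
  · intro h
    obtain ⟨wk⟩ := h
    set q := wk.bypass with hq
    have hpath : q.IsPath := wk.bypass_isPath
    cases hq' : q with
    | nil => exact absurd rfl hz
    | cons hadj q' =>
      rename_i y
      rw [hq'] at hpath
      rw [SimpleGraph.Walk.cons_isPath_iff] at hpath
      rw [openGraph, SimpleGraph.fromEdgeSet_adj] at hadj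
      refine ⟨y, (hG y).1 hadj.1, ?_⟩
      exact CutObserver.reachable_avoiding_of_walk q' hpath.2
  · rintro ⟨y, hyU, hyz⟩
    have hoy : o ≠ y := fun h => hoU (h ▸ hyU)
    have hadj : (openGraph ω).Adj o y := by
      rw [openGraph, SimpleGraph.fromEdgeSet_adj]; exact ⟨(hG y).2 hyU, hoy⟩
    exact hadj.reachable.trans (CutObserver.reachable_mono inter_subset_left hyz)

/-- **The hypothesis of `selfGluingLoss_ge` from the lonelier-set lemma.**  If the weights at `o` are deterministic
(`0` or `1`), the set `U` of vertices glued to `o` is nonempty, consists of relays, and contains a relay `y` no more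
light-prone than `p` in the graph with the edges at `o` removed, and `v s(o,p) = 0`, then
`μ_v(o ↮ p, |π(o)| ≤ j) ≤ μ_v(o ↮ p, |π(p)| ≤ j)`. [folklore; `observerSet_le_of_lonelier` + transfer] -/
theorem hyp_of_gluedStar (v : Sym2 (Fin n) → unitInterval) (A : Finset (Fin n)) (j : ℕ) {o p : Fin n}
    (hoA : o ∉ A) (hpA : p ∈ A) (hv : v s(o, p) = 0)
    (hdet : ∀ y : Fin n, v s(o, y) = 0 ∨ v s(o, y) = 1)
    (hUA : ∀ y : Fin n, v s(o, y) = 1 → y ∈ A)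
    {y₀ : Fin n} (hy₀ : v s(o, y₀) = 1)
    (hle : (prodBernoulli fun e : Sym2 (Fin n) => if e ∈ {e : Sym2 (Fin n) | o ∉ e} then v e else 0).real
        {ω : BondConfig (Fin n) | (A.filter fun z => ω ∈ openConn y₀ z).card ≤ j} ≤
      (prodBernoulli fun e : Sym2 (Fin n) => if e ∈ {e : Sym2 (Fin n) | o ∉ e} then v e else 0).real
        {ω : BondConfig (Fin n) | (A.filter fun z => ω ∈ openConn p z).card ≤ j}) :
    (prodBernoulli v).real ((openConn o p)ᶜ ∩
        {ω : BondConfig (Fin n) | (A.filter fun z => ω ∈ openConn o z).card ≤ j}) ≤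
      (prodBernoulli v).real ((openConn o p)ᶜ ∩
        {ω : BondConfig (Fin n) | (A.filter fun z => ω ∈ openConn p z).card ≤ j}) := by
  set μ := prodBernoulli v with hμ
  set u : Sym2 (Fin n) → unitInterval := fun e => if e ∈ {e : Sym2 (Fin n) | o ∉ e} then v e else 0 with hu
  set U : Finset (Fin n) := Finset.univ.filter fun y => v s(o, y) = 1 with hUdef
  have hy₀U : y₀ ∈ U := Finset.mem_filter.2 ⟨Finset.mem_univ _, hy₀⟩
  have hUA' : ∀ y ∈ U, y ∈ A := fun y hy => hUA y (Finset.mem_filter.1 hy).2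
  have hoU : o ∉ U := fun h => hoA (hUA' o h)
  have hpo : p ≠ o := fun h => hoA (h ▸ hpA)
  have hpU : p ∉ U := by
    intro h
    have := (Finset.mem_filter.1 h).2
    rw [hv] at this
    exact zero_ne_one this
  -- the full-measure event: open edges at o are exactly the edges to U
  set G : Set (BondConfig (Fin n)) := {ω | ∀ y : Fin n, s(o, y) ∈ ω ↔ y ∈ U} with hGdef
  have hGae : ∀ᵐ ω ∂μ, ω ∈ G := by
    have h : ∀ y : Fin n, ∀ᵐ ω ∂μ, (s(o, y) ∈ ω ↔ y ∈ U) := by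
      intro y
      rcases hdet y with h0 | h1
      · have hyU : y ∉ U := by
          intro h; have := (Finset.mem_filter.1 h).2; rw [h0] at this; exact zero_ne_one this
        filter_upwards [prodBernoulli_ae_notMem v h0] with ω hω
        exact iff_of_false hω hyU
      · have hyU : y ∈ U := Finset.mem_filter.2 ⟨Finset.mem_univ _, h1⟩
        filter_upwards [prodBernoulli_ae_mem_of_eq_one v h1] with ω hω
        exact iff_of_true hω hyU
    filter_upwards [ae_all_iff.2 h] with ω hω
    exact hω
  -- lonelier in the graph without the edges at o
  have hlon := observerSet_le_of_lonelier u A U y₀ p hy₀U j hle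
  -- identify the two events on G
  set S1 : Set (BondConfig (Fin n)) := {ω | (∀ x ∈ U, ω ∉ openConn p x) ∧
      1 ≤ (A.filter fun z => ∃ x ∈ U, ω ∈ openConn x z).card ∧
      (A.filter fun z => ∃ x ∈ U, ω ∈ openConn x z).card ≤ j} with hS1
  set S2 : Set (BondConfig (Fin n)) := {ω | (∀ x ∈ U, ω ∉ openConn p x) ∧
      (A.filter fun z => ω ∈ openConn p z).card ≤ j} with hS2
  -- on G: o ↮ p iff p is not joined to U avoiding o
  have hDiff : ∀ ω ∈ G, (ω ∈ (openConn o p : Set (BondConfig (Fin n)))ᶜ ↔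
      ∀ x ∈ U, (ω ∩ {e | o ∉ e}) ∉ openConn p x) := by
    intro ω hωG
    rw [mem_compl_iff]
    change ¬ (openGraph ω).Reachable o p ↔ _
    rw [reachable_from_obs_iff ω U hoU hωG p hpo]
    simp only [not_exists, not_and]
    refine forall_congr' fun x => forall_congr' fun hx => ?_
    change _ ↔ ¬ (openGraph (ω ∩ {e | o ∉ e})).Reachable p x
    rw [SimpleGraph.reachable_comm]
  have hfilt_o : ∀ ω ∈ G, (A.filter fun z => ω ∈ openConn o z) =
      A.filter fun z => ∃ x ∈ U, (ω ∩ {e | o ∉ e}) ∈ openConn x z := by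
    intro ω hωG
    apply Finset.filter_congr
    intro z hz
    have hzo : z ≠ o := fun h => hoA (h ▸ hz)
    exact reachable_from_obs_iff ω U hoU hωG z hzo
  have hfilt_p : ∀ ω ∈ G, ω ∈ (openConn o p : Set (BondConfig (Fin n)))ᶜ →
      (A.filter fun z => ω ∈ openConn p z) = A.filter fun z => (ω ∩ {e | o ∉ e}) ∈ openConn p z := by
    intro ω _ hD
    apply Finset.filter_congr
    intro z _
    have hpo' : ¬ (openGraph ω).Reachable p o := fun h => hD (h.symm : (openGraph ω).Reachable o p)
    exact ⟨fun h => CutObserver.reachable_avoiding_of_not_reachable hpo' h,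
      fun h => CutObserver.reachable_mono inter_subset_left h⟩
  have hcard_pos : ∀ ω : BondConfig (Fin n), 1 ≤ (A.filter fun z => ∃ x ∈ U, ω ∈ openConn x z).card := by
    intro ω
    apply Finset.card_pos.2
    exact ⟨y₀, Finset.mem_filter.2 ⟨hUA' y₀ hy₀U, y₀, hy₀U, (SimpleGraph.Reachable.refl y₀ :
      (openGraph ω).Reachable y₀ y₀)⟩⟩
  have hE1 : ∀ ω ∈ G, ω ∈ (openConn o p)ᶜ ∩ {ω : BondConfig (Fin n) |
        (A.filter fun z => ω ∈ openConn o z).card ≤ j} ↔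
      ω ∈ {ω : BondConfig (Fin n) | ω ∩ {e | o ∉ e} ∈ S1} := by
    intro ω hωG
    simp only [mem_inter_iff, mem_setOf_eq, hS1]
    rw [hDiff ω hωG, hfilt_o ω hωG]
    constructor
    · rintro ⟨h1, h2⟩; exact ⟨h1, hcard_pos _, h2⟩
    · rintro ⟨h1, -, h2⟩; exact ⟨h1, h2⟩
  have hE2 : ∀ ω ∈ G, ω ∈ (openConn o p)ᶜ ∩ {ω : BondConfig (Fin n) |
        (A.filter fun z => ω ∈ openConn p z).card ≤ j} ↔
      ω ∈ {ω : BondConfig (Fin n) | ω ∩ {e | o ∉ e} ∈ S2} := by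
    intro ω hωG
    simp only [mem_inter_iff, mem_setOf_eq, hS2]
    constructor
    · rintro ⟨h1, h2⟩
      refine ⟨(hDiff ω hωG).1 h1, ?_⟩
      rw [← hfilt_p ω hωG h1]; exact h2
    · rintro ⟨h1, h2⟩
      have hD := (hDiff ω hωG).2 h1
      refine ⟨hD, ?_⟩
      rw [hfilt_p ω hωG hD]; exact h2
  have hm1 : μ.real ((openConn o p)ᶜ ∩ {ω : BondConfig (Fin n) |
        (A.filter fun z => ω ∈ openConn o z).card ≤ j}) =
      μ.real {ω : BondConfig (Fin n) | ω ∩ {e | o ∉ e} ∈ S1} := by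
    refine measureReal_congr (hGae.mono fun ω hω => ?_)
    exact propext (hE1 ω hω)
  have hm2 : μ.real ((openConn o p)ᶜ ∩ {ω : BondConfig (Fin n) |
        (A.filter fun z => ω ∈ openConn p z).card ≤ j}) =
      μ.real {ω : BondConfig (Fin n) | ω ∩ {e | o ∉ e} ∈ S2} := by
    refine measureReal_congr (hGae.mono fun ω hω => ?_)
    exact propext (hE2 ω hω)
  rw [hm1, hm2, CutObserver.measureReal_preimage_avoid v o S1, CutObserver.measureReal_preimage_avoid v o S2]
  convert hlon using 7
  all_goals
    apply congrArg Finset.card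
    ext z
    simp only [Finset.mem_filter]

/-- The loss of the glued port is nonnegative: `μ_{v⁺}(R_p) ≤ μ_v(R_p)`. [folklore] -/
theorem loss_self_nonneg (v : Sym2 (Fin n) → unitInterval) (A : Finset (Fin n)) (j : ℕ) {o p : Fin n} (hop : o ≠ p)
    (hv : v s(o, p) = 0) :
    (prodBernoulli (Function.update v s(o, p) 1)).real
        {ω : BondConfig (Fin n) | (A.filter fun z => ω ∈ openConn p z).card ≤ j} ≤
      (prodBernoulli v).real {ω : BondConfig (Fin n) | (A.filter fun z => ω ∈ openConn p z).card ≤ j} := by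
  rw [ChampionStability.real_update_one_eq v hv]
  apply measureReal_mono _ (measure_ne_top _ _)
  intro ω hω
  simp only [mem_preimage, mem_setOf_eq] at hω ⊢
  rw [filter_insert_self ω A hop] at hω
  exact le_trans (Finset.card_le_card Finset.subset_union_left) hω

/-- If every edge at `o` has weight `0`, gluing `o` onto `p` does not change the lightness of any `x ≠ o`. [folklore] -/
theorem loss_passenger_eq_zero_of_isolated (v : Sym2 (Fin n) → unitInterval) (A : Finset (Fin n)) (j : ℕ)
    {o p : Fin n} (hop : o ≠ p) (hoA : o ∉ A) (hzero : ∀ y : Fin n, v s(o, y) = 0) {x : Fin n} (hxo : x ≠ o) :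
    (prodBernoulli (Function.update v s(o, p) 1)).real
        {ω : BondConfig (Fin n) | (A.filter fun z => ω ∈ openConn x z).card ≤ j} =
      (prodBernoulli v).real {ω : BondConfig (Fin n) | (A.filter fun z => ω ∈ openConn x z).card ≤ j} := by
  rw [ChampionStability.real_update_one_eq v (hzero p)]
  -- a.s. no edge at o is open
  have hae : ∀ᵐ ω ∂(prodBernoulli v), ∀ y : Fin n, s(o, y) ∉ ω := by
    have h : ∀ y : Fin n, ∀ᵐ ω ∂(prodBernoulli v), s(o, y) ∉ ω := fun y => prodBernoulli_ae_notMem v (hzero y)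
    exact ae_all_iff.2 h
  refine measureReal_congr (hae.mono fun ω hω => ?_)
  -- on such ω, o is isolated: nothing but o is reachable from o
  have hiso : ∀ z : Fin n, (openGraph ω).Reachable o z → z = o := by
    intro z hz
    by_contra hne
    obtain ⟨wk⟩ := hz
    cases wk with
    | nil => exact hne rfl
    | @cons _ y _ hadj _ =>
      rw [openGraph, SimpleGraph.fromEdgeSet_adj] at hadj
      exact hω y hadj.1
  have hxo' : ¬ (openGraph ω).Reachable x o := fun h => hxo (hiso x h.symm)
  have hBo : (A.filter fun z => ω ∈ openConn o z) = ∅ := by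
    apply Finset.filter_false_of_mem
    intro z hz hoz
    exact hoA ((hiso z hoz) ▸ hz)
  have key : (A.filter fun z => insert s(o, p) ω ∈ openConn x z) = A.filter fun z => ω ∈ openConn x z := by
    by_cases hxp : (openGraph ω).Reachable x p
    · have hBpx : (A.filter fun z => ω ∈ openConn p z) = A.filter fun z => ω ∈ openConn x z := by
        apply Finset.filter_congr
        intro z _
        exact ⟨fun h => (hxp.trans h : (openGraph ω).Reachable x z),
          fun h => (hxp.symm.trans h : (openGraph ω).Reachable p z)⟩
      have hsub := filter_insert_passenger_subset ω A x hop
      rw [hBpx, hBo, Finset.union_empty, Finset.union_idempotent] at hsub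
      have hsup : (A.filter fun z => ω ∈ openConn x z) ⊆ A.filter fun z => insert s(o, p) ω ∈ openConn x z := by
        intro z hz
        simp only [Finset.mem_filter] at hz ⊢
        exact ⟨hz.1, (CutObserver.reachable_mono (subset_insert _ _) hz.2 :
          (openGraph (insert s(o, p) ω)).Reachable x z)⟩
      exact Finset.Subset.antisymm hsub hsup
    · exact filter_insert_passenger_of_not ω A hop hxo' hxp
  have key' : insert s(o, p) ω ∈ {ω : BondConfig (Fin n) | (A.filter fun z => ω ∈ openConn x z).card ≤ j} ↔
      ω ∈ {ω : BondConfig (Fin n) | (A.filter fun z => ω ∈ openConn x z).card ≤ j} := by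
    simp only [mem_setOf_eq, key]
  exact propext key'

/-- **(TOP') for a relay-neighboured observer.**  If `v s(o,p) = 0`, `o ∉ A ∋ p`, and every other positive-weight edge at `o`
goes to a relay that is no more light-prone than `p` in the graph with the edges at `o` removed, then gluing `o` onto `p`
costs `p` at least as much lightness as it costs any `x ≠ o`:  `loss(x) ≤ loss(p)`.  Proof: the losses are affine in each
other weight at `o`, so it suffices to treat weights at `o` in `{0,1}`; then either `o` is isolated (`loss(x) = 0`) or
`hyp_of_gluedStar` + `selfGluingLoss_ge`. -/
theorem selfGluingLoss_ge_star (v : Sym2 (Fin n) → unitInterval) (A : Finset (Fin n)) (j : ℕ) {o p : Fin n}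
    (hoA : o ∉ A) (hpA : p ∈ A) (hv : v s(o, p) = 0) {x : Fin n} (hxo : x ≠ o)
    (hobs : ∀ y : Fin n, v s(o, y) ≠ 0 → y ∈ A ∧
      (prodBernoulli fun e : Sym2 (Fin n) => if e ∈ {e : Sym2 (Fin n) | o ∉ e} then v e else 0).real
          {ω : BondConfig (Fin n) | (A.filter fun z => ω ∈ openConn y z).card ≤ j} ≤
        (prodBernoulli fun e : Sym2 (Fin n) => if e ∈ {e : Sym2 (Fin n) | o ∉ e} then v e else 0).real
          {ω : BondConfig (Fin n) | (A.filter fun z => ω ∈ openConn p z).card ≤ j}) :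
    (prodBernoulli v).real {ω : BondConfig (Fin n) | (A.filter fun z => ω ∈ openConn x z).card ≤ j} -
        (prodBernoulli (Function.update v s(o, p) 1)).real
          {ω : BondConfig (Fin n) | (A.filter fun z => ω ∈ openConn x z).card ≤ j} ≤
      (prodBernoulli v).real {ω : BondConfig (Fin n) | (A.filter fun z => ω ∈ openConn p z).card ≤ j} -
        (prodBernoulli (Function.update v s(o, p) 1)).real
          {ω : BondConfig (Fin n) | (A.filter fun z => ω ∈ openConn p z).card ≤ j} := by
  have hop : o ≠ p := fun h => hoA (h ▸ hpA)
  -- induction on the number of fractional weights at o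
  suffices H : ∀ (k : ℕ) (v : Sym2 (Fin n) → unitInterval),
      (Finset.univ.filter fun y : Fin n => v s(o, y) ≠ 0 ∧ v s(o, y) ≠ 1).card = k → v s(o, p) = 0 →
      (∀ y : Fin n, v s(o, y) ≠ 0 → y ∈ A ∧
        (prodBernoulli fun e : Sym2 (Fin n) => if e ∈ {e : Sym2 (Fin n) | o ∉ e} then v e else 0).real
            {ω : BondConfig (Fin n) | (A.filter fun z => ω ∈ openConn y z).card ≤ j} ≤
          (prodBernoulli fun e : Sym2 (Fin n) => if e ∈ {e : Sym2 (Fin n) | o ∉ e} then v e else 0).real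
            {ω : BondConfig (Fin n) | (A.filter fun z => ω ∈ openConn p z).card ≤ j}) →
      (prodBernoulli v).real {ω : BondConfig (Fin n) | (A.filter fun z => ω ∈ openConn x z).card ≤ j} -
          (prodBernoulli (Function.update v s(o, p) 1)).real
            {ω : BondConfig (Fin n) | (A.filter fun z => ω ∈ openConn x z).card ≤ j} ≤
        (prodBernoulli v).real {ω : BondConfig (Fin n) | (A.filter fun z => ω ∈ openConn p z).card ≤ j} -
          (prodBernoulli (Function.update v s(o, p) 1)).real
            {ω : BondConfig (Fin n) | (A.filter fun z => ω ∈ openConn p z).card ≤ j} from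
    H _ v rfl hv hobs
  intro k
  induction k using Nat.strong_induction_on with
  | _ k ih =>
  intro v hk hv hobs
  set Rx : Set (BondConfig (Fin n)) := {ω | (A.filter fun z => ω ∈ openConn x z).card ≤ j} with hRx
  set Rp : Set (BondConfig (Fin n)) := {ω | (A.filter fun z => ω ∈ openConn p z).card ≤ j} with hRp
  by_cases hfrac : ∃ y : Fin n, v s(o, y) ≠ 0 ∧ v s(o, y) ≠ 1
  · -- push the fractional weight at s(o,y) to 0 and to 1
    obtain ⟨y, hy0, hy1⟩ := hfrac
    set f : Sym2 (Fin n) := s(o, y) with hf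
    have hfe : f ≠ s(o, p) := by
      intro h
      apply hy0
      rw [h]; exact hv
    -- the restricted weights do not change
    have hu : ∀ t : unitInterval, (fun e : Sym2 (Fin n) => if e ∈ {e : Sym2 (Fin n) | o ∉ e} then
        Function.update v f t e else 0) =
        fun e : Sym2 (Fin n) => if e ∈ {e : Sym2 (Fin n) | o ∉ e} then v e else 0 := by
      intro t
      funext e
      by_cases he : e ∈ {e : Sym2 (Fin n) | o ∉ e}
      · have hef : e ≠ f := by
          intro h'; apply he; rw [h', hf]; exact Sym2.mem_mk_left o y
        simp only [he, if_true, Function.update_of_ne hef]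
      · simp only [he, if_false]
    have hcount : ∀ t : unitInterval, (t = 0 ∨ t = 1) →
        (Finset.univ.filter fun z : Fin n => Function.update v f t s(o, z) ≠ 0 ∧
          Function.update v f t s(o, z) ≠ 1).card < k := by
      intro t ht
      rw [← hk]
      apply Finset.card_lt_card
      rw [Finset.ssubset_iff_of_subset]
      · refine ⟨y, Finset.mem_filter.2 ⟨Finset.mem_univ _, hy0, hy1⟩, ?_⟩
        intro h
        have h' := (Finset.mem_filter.1 h).2
        rw [← hf, Function.update_self] at h'
        rcases ht with ht | ht
        · exact h'.1 ht
        · exact h'.2 ht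
      · intro z hz
        have hz' := (Finset.mem_filter.1 hz).2
        refine Finset.mem_filter.2 ⟨Finset.mem_univ _, ?_⟩
        by_cases hzf : s(o, z) = f
        · rw [hzf, Function.update_self] at hz'
          rcases ht with ht | ht
          · exact absurd ht hz'.1
          · exact absurd ht hz'.2
        · rwa [Function.update_of_ne hzf] at hz'
    have hvt : ∀ t : unitInterval, Function.update v f t s(o, p) = 0 := by
      intro t; rw [Function.update_of_ne (Ne.symm hfe)]; exact hv
    have hobst : ∀ t : unitInterval, ∀ z : Fin n, Function.update v f t s(o, z) ≠ 0 → z ∈ A ∧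
        (prodBernoulli fun e : Sym2 (Fin n) => if e ∈ {e : Sym2 (Fin n) | o ∉ e} then
            Function.update v f t e else 0).real
            {ω : BondConfig (Fin n) | (A.filter fun z' => ω ∈ openConn z z').card ≤ j} ≤
          (prodBernoulli fun e : Sym2 (Fin n) => if e ∈ {e : Sym2 (Fin n) | o ∉ e} then
            Function.update v f t e else 0).real
            {ω : BondConfig (Fin n) | (A.filter fun z' => ω ∈ openConn p z').card ≤ j} := by
      intro t z hz
      rw [hu t]
      by_cases hzf : s(o, z) = f
      · have hzy : z = y := by
          have hy' : y ∈ s(o, z) := by rw [hzf, hf]; exact Sym2.mem_mk_right o y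
          rcases Sym2.mem_iff.1 hy' with h1 | h1
          · -- y = o: then f is the diagonal; z ∈ s(o,o) forces z = o = y
            have hz' : z ∈ f := by rw [← hzf]; exact Sym2.mem_mk_right o z
            rw [hf, h1, Sym2.mem_iff, or_self] at hz'
            rw [hz', h1]
          · exact h1.symm
        rw [hzy]
        exact hobs y hy0
      · rw [Function.update_of_ne hzf] at hz
        exact hobs z hz
    have ih0 := ih _ (hcount 0 (Or.inl rfl)) (Function.update v f 0) rfl (hvt 0) (hobst 0)
    have ih1 := ih _ (hcount 1 (Or.inr rfl)) (Function.update v f 1) rfl (hvt 1) (hobst 1)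
    -- affinity in the weight of f
    have hcomm : ∀ t : unitInterval, Function.update (Function.update v f t) s(o, p) 1 =
        Function.update (Function.update v s(o, p) 1) f t := fun t => Function.update_comm hfe _ _ _
    rw [hcomm 0] at ih0
    rw [hcomm 1] at ih1
    have e1 := TieLocus.real_oneBond v f Rx
    have e2 := TieLocus.real_oneBond v f Rp
    have e3 := TieLocus.real_oneBond (Function.update v s(o, p) 1) f Rx
    have e4 := TieLocus.real_oneBond (Function.update v s(o, p) 1) f Rp
    have hvf : (Function.update v s(o, p) 1) f = v f := Function.update_of_ne hfe _ _
    rw [hvf] at e3 e4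
    have h0 : 0 ≤ (v f : ℝ) := (v f).2.1
    have h1 : (v f : ℝ) ≤ 1 := (v f).2.2
    rw [e1, e2, e3, e4]
    nlinarith [mul_nonneg (sub_nonneg.2 h1) (sub_nonneg.2 ih0), mul_nonneg h0 (sub_nonneg.2 ih1)]
  · -- all weights at o are 0 or 1
    push Not at hfrac
    have hdet : ∀ y : Fin n, v s(o, y) = 0 ∨ v s(o, y) = 1 := by
      intro y
      by_cases h : v s(o, y) = 0
      · exact Or.inl h
      · exact Or.inr (hfrac y h)
    by_cases hU : ∃ y₀ : Fin n, v s(o, y₀) = 1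
    · obtain ⟨y₀, hy₀⟩ := hU
      have hne : v s(o, y₀) ≠ 0 := by rw [hy₀]; exact one_ne_zero
      have hyp := hyp_of_gluedStar v A j hoA hpA hv hdet
        (fun y hy => (hobs y (by rw [hy]; exact one_ne_zero)).1) hy₀ (hobs y₀ hne).2
      exact selfGluingLoss_ge v A j hop hv x hyp
    · push Not at hU
      have hzero : ∀ y : Fin n, v s(o, y) = 0 := by
        intro y
        rcases hdet y with h | h
        · exact h
        · exact absurd h (hU y)
      rw [loss_passenger_eq_zero_of_isolated v A j hop hoA hzero hxo, sub_self]
      exact sub_nonneg.2 (loss_self_nonneg v A j hop hv)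

end PatternLightestStar

end Summit.CriticalPhenomena.PercolationContinuityZ3.Theorems

end
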